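import Literature.Computability.Cryptography.CubicClassPost
import HarnessLib

/-!
# The class-group stage: the rows of the post-processor and the order of the group they generate

Topic `Computability/Cryptography`; theorem file (with two auxiliary definitions) about `CubicClassPost.lean`, the classical
post-processor of the class-group stage of the crux `LinnikCubicClassGroups.PureCubicClassGroupFBQP` (line
`arakelov-giant-step-cycle`; consumer: the proof of `CubicClassSampling.ClaimPost`). No named facts.

When all `2n` unit outcomes decode, `pairRowsR` returns the `n` rows `(deriveR u_{2i} u_{2i+1} t)_{t<T}` (`pairRowsR_ofFn`). If
every entry of row `i` is `s_{i,t}.val / h + (integer)` for vectors `s_i ∈ (ℤ/h)^T` (exact recovery, `CubicClassPostRecover`),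
then the common denominator `N = lcmDen` divides `h` (`lcmDen_ofFn_dvd`), the natural rows `N ζ mod N` (`natRows`) are the
images of the `s_i` under the inverse of the embedding `ℤ/N ↪ ℤ/h, x ↦ (h/N) x` (`scaleHom`, `scaleHom_entry`), and the tree's
subgroup-order algorithm returns the order of the subgroup of `(ℤ/h)^T` generated by the `s_i`:
**`subgroupOrderPure_natRows_eq_card`** (`Howell.subgroupOrderNat_getD_eq_pure`, `SubgroupOrder.subgroupOrder_eq_card_closure`,
injectivity of `scaleHom`). [Cheung–Mosca 2001, §3; Hallgren 2005, §4]

## References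

* K. K. H. Cheung, M. Mosca, QIC 1 (2001), §3. [CheungMosca2001]
* S. Hallgren, STOC 2005, §4. [Hallgren2005]
-/

noncomputable section

namespace Literature.Computability.Cryptography

namespace CubicClassPost

open Finset

/-! ### The rows of an outcome list all of whose units decode -/

section Rows

variable (P : PostParams)

/-- Two decoding outcomes in front give one row. [folklore] -/
theorem pairRowsR_cons_cons {c c' : ℕ} {cs : List ℕ} {u u' : ℤ × ℕ} (hu : P.decodeUnit c = some u)
    (hu' : P.decodeUnit c' = some u') :
    P.pairRowsR (c :: c' :: cs) = (List.range P.T).map (P.deriveR u u') :: P.pairRowsR cs := by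
  rw [PostParams.pairRowsR, hu, hu']
  rfl

/-- The rows of a flattened list of decoding pairs. [folklore] -/
theorem pairRowsR_flatten {n : ℕ} (a b : Fin n → ℕ) (ua ub : Fin n → ℤ × ℕ) (ha : ∀ i, P.decodeUnit (a i) = some (ua i))
    (hb : ∀ i, P.decodeUnit (b i) = some (ub i)) :
    P.pairRowsR (List.ofFn fun i => [a i, b i]).flatten =
      List.ofFn fun i => (List.range P.T).map (P.deriveR (ua i) (ub i)) := by
  induction n with
  | zero => simp [PostParams.pairRowsR]
  | succ n ih =>
    rw [List.ofFn_succ, List.flatten_cons, List.ofFn_succ, List.cons_append, List.cons_append, List.nil_append,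
      pairRowsR_cons_cons P (ha 0) (hb 0), ih (fun i => a i.succ) (fun i => b i.succ) (fun i => ua i.succ)
        (fun i => ub i.succ) (fun i => ha i.succ) (fun i => hb i.succ)]

/-- **The rows of `2n` decoding outcomes**: `pairRowsR [c_0, …, c_{2n-1}]` is the list of the `n` rows
`(deriveR u_{2i} u_{2i+1} t)_{t < T}`. [cite: Hallgren2005, §4] -/
theorem pairRowsR_ofFn {n : ℕ} (cs : Fin (2 * n) → ℕ) (dec : Fin (2 * n) → ℤ × ℕ)
    (hdec : ∀ j, P.decodeUnit (cs j) = some (dec j)) :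
    P.pairRowsR (List.ofFn cs) = List.ofFn fun i : Fin n =>
      (List.range P.T).map (P.deriveR (dec ⟨2 * i, by omega⟩) (dec ⟨2 * i + 1, by omega⟩)) := by
  rw [List.ofFn_mul' cs]
  have h2 : ∀ i : Fin n, (List.ofFn fun j : Fin 2 => cs ⟨2 * (i : ℕ) + j, by omega⟩) =
      [cs ⟨2 * i, by omega⟩, cs ⟨2 * i + 1, by omega⟩] := by
    intro i
    rw [List.ofFn_succ, List.ofFn_succ, List.ofFn_zero]
    rfl
  simp_rw [h2]
  exact pairRowsR_flatten P _ _ _ _ (fun i => hdec _) (fun i => hdec _)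

end Rows

/-! ### The common denominator -/

/-- The `lcm`-fold divides `m` iff the seed and all members do. [folklore] -/
theorem foldl_lcm_dvd_iff {L : List ℕ} {a m : ℕ} : L.foldl Nat.lcm a ∣ m ↔ a ∣ m ∧ ∀ x ∈ L, x ∣ m := by
  induction L generalizing a with
  | nil => simp
  | cons x L ih =>
    rw [List.foldl_cons, ih, Nat.lcm_dvd_iff]
    simp only [List.mem_cons, forall_eq_or_imp, and_assoc]

/-- Members divide the `lcm`-fold. [folklore] -/
theorem dvd_foldl_lcm {L : List ℕ} {a x : ℕ} (hx : x ∈ L) : x ∣ L.foldl Nat.lcm a :=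
  ((foldl_lcm_dvd_iff (L := L) (a := a)).1 dvd_rfl).2 x hx

/-- **The common denominator divides `h`** when all denominators do. [folklore] -/
theorem lcmDen_dvd {rows : List (List ℚ)} {h : ℕ} (hd : ∀ row ∈ rows, ∀ ζ ∈ row, ζ.den ∣ h) : lcmDen rows ∣ h := by
  rw [lcmDen, foldl_lcm_dvd_iff]
  refine ⟨one_dvd _, fun x hx => ?_⟩
  obtain ⟨row, hrow, rfl⟩ := List.mem_map.1 hx
  rw [foldl_lcm_dvd_iff]
  refine ⟨one_dvd _, fun d hd' => ?_⟩
  obtain ⟨ζ, hζ, rfl⟩ := List.mem_map.1 hd'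
  exact hd row hrow ζ hζ

/-- **Every denominator divides the common denominator.** [folklore] -/
theorem den_dvd_lcmDen {rows : List (List ℚ)} {row : List ℚ} (hrow : row ∈ rows) {ζ : ℚ} (hζ : ζ ∈ row) :
    ζ.den ∣ lcmDen rows :=
  (dvd_foldl_lcm (List.mem_map.2 ⟨ζ, hζ, rfl⟩)).trans (dvd_foldl_lcm (List.mem_map.2 ⟨row, hrow, rfl⟩))

/-- Membership in the list of rows `(rows i t)_{t<T}`, `i < n`. [folklore] -/
theorem mem_rows_ofFn_iff {T n : ℕ} (rows : Fin n → ℕ → ℚ) (ζ : ℚ) :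
    (∃ row ∈ (List.ofFn fun i => (List.range T).map (rows i)), ζ ∈ row) ↔ ∃ (i : Fin n) (t : Fin T), rows i t = ζ := by
  constructor
  · rintro ⟨row, hrow, hζ⟩
    obtain ⟨i, rfl⟩ := List.mem_ofFn.1 hrow
    obtain ⟨t, ht, rfl⟩ := List.mem_map.1 hζ
    exact ⟨i, ⟨t, List.mem_range.1 ht⟩, rfl⟩
  · rintro ⟨i, t, rfl⟩
    exact ⟨_, List.mem_ofFn.2 ⟨i, rfl⟩, List.mem_map.2 ⟨t, List.mem_range.2 t.isLt, rfl⟩⟩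

/-- The common denominator of the rows `(rows i t)` divides `h` when all their denominators do. [folklore] -/
theorem lcmDen_ofFn_dvd {T n h : ℕ} (rows : Fin n → ℕ → ℚ) (hd : ∀ (i : Fin n) (t : Fin T), (rows i t).den ∣ h) :
    lcmDen (List.ofFn fun i => (List.range T).map (rows i)) ∣ h := by
  refine lcmDen_dvd fun row hrow ζ hζ => ?_
  obtain ⟨i, t, rfl⟩ := (mem_rows_ofFn_iff rows ζ).1 ⟨row, hrow, hζ⟩
  exact hd i t

/-- Each `(rows i t).den` divides the common denominator of the rows. [folklore] -/
theorem den_dvd_lcmDen_ofFn {T n : ℕ} (rows : Fin n → ℕ → ℚ) (i : Fin n) (t : Fin T) :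
    (rows i t).den ∣ lcmDen (List.ofFn fun i => (List.range T).map (rows i)) := by
  obtain ⟨row, hrow, hζ⟩ := (mem_rows_ofFn_iff rows (rows i t)).2 ⟨i, t, rfl⟩
  exact den_dvd_lcmDen hrow hζ

/-! ### The embedding `ℤ/N ↪ ℤ/h` and the natural rows -/

section Scale

variable (N h : ℕ)

/-- Multiplication by `h/N` from `ℤ` to `ℤ/h` (vanishes on `N ℤ` when `N ∣ h`). [folklore] -/
def scaleInt : ℤ →+ ZMod h :=
  AddMonoidHom.mk' (fun z => ((z * (h / N : ℕ) : ℤ) : ZMod h)) (by intro a b; push_cast; ring)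

/-- `scaleInt` on an integer. [folklore] -/
@[simp] theorem scaleInt_apply (z : ℤ) : scaleInt N h z = ((z * (h / N : ℕ) : ℤ) : ZMod h) := rfl

variable {N h}

/-- `scaleInt` kills `N` when `N ∣ h`. [folklore] -/
theorem scaleInt_natCast (hN : N ∣ h) : scaleInt N h (N : ℤ) = 0 := by
  rw [scaleInt_apply]
  have : ((N : ℤ) * (h / N : ℕ)) = (h : ℤ) := by exact_mod_cast Nat.mul_div_cancel' hN
  rw [this, Int.cast_natCast, ZMod.natCast_self]

/-- **The embedding `ℤ/N ↪ ℤ/h`, `x ↦ (h/N) x`** (for `N ∣ h`). [folklore] -/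
def scaleHom (hN : N ∣ h) : ZMod N →+ ZMod h := ZMod.lift N ⟨scaleInt N h, scaleInt_natCast hN⟩

/-- `scaleHom` on an integer residue. [folklore] -/
theorem scaleHom_intCast (hN : N ∣ h) (z : ℤ) : scaleHom hN (z : ZMod N) = ((z * (h / N : ℕ) : ℤ) : ZMod h) :=
  ZMod.lift_coe N _ z

/-- **`scaleHom` is injective** (`h ≠ 0`). [folklore] -/
theorem scaleHom_injective (hN : N ∣ h) (hh : h ≠ 0) : Function.Injective (scaleHom hN) := by
  rw [scaleHom, ZMod.lift_injective]
  intro m hm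
  change scaleInt N h m = 0 at hm
  rw [scaleInt_apply, ZMod.intCast_zmod_eq_zero_iff_dvd] at hm
  rw [ZMod.intCast_zmod_eq_zero_iff_dvd]
  have hq0 : ((h / N : ℕ) : ℤ) ≠ 0 := by
    have : h / N ≠ 0 := fun h0 => hh (by rw [← Nat.mul_div_cancel' hN, h0, mul_zero])
    exact_mod_cast this
  have hfac : (h : ℤ) = N * (h / N : ℕ) := by exact_mod_cast (Nat.mul_div_cancel' hN).symm
  rw [hfac] at hm
  exact (mul_dvd_mul_iff_right hq0).1 hm

/-- **The natural entry of `ζ = s.val/h + m`**: if `ζ.den ∣ N ∣ h` then `(N ζ).num mod N`, read in `ℤ/N`, is mapped by `scaleHom` to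
`s ∈ ℤ/h`. [cite: CheungMosca2001, §3] -/
theorem scaleHom_entry [NeZero h] (hN : N ∣ h) {ζ : ℚ} {s : ZMod h} {m : ℤ} (hζ : ζ = (s.val : ℚ) / h + m)
    (hden : ζ.den ∣ N) : scaleHom hN ((((ζ * N).num % (N : ℤ)).toNat : ℕ) : ZMod N) = s := by
  have hh0 : (h : ℚ) ≠ 0 := by exact_mod_cast NeZero.ne h
  have hN0 : N ≠ 0 := fun h0 => NeZero.ne h (Nat.eq_zero_of_zero_dvd (h0 ▸ hN))
  -- `ζ N` is the integer `z = ζ.num (N / ζ.den)`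
  obtain ⟨k, hk⟩ := hden
  set z : ℤ := ζ.num * k with hz
  have hzq : ζ * N = (z : ℚ) := by
    rw [hk, hz]; push_cast
    rw [← mul_assoc, Rat.mul_den_eq_num]
  have hnum : (ζ * N).num = z := by rw [hzq, Rat.num_intCast]
  rw [hnum]
  -- reduce modulo `N` and map
  have hmod : ((((z % (N : ℤ)).toNat : ℕ) : ZMod N)) = (z : ZMod N) := by
    have h0 : 0 ≤ z % (N : ℤ) := Int.emod_nonneg _ (by exact_mod_cast hN0)
    rw [← Int.cast_natCast, Int.toNat_of_nonneg h0, ZMod.intCast_mod]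
  rw [hmod, scaleHom_intCast]
  -- `z (h/N) = s.val + m h` as integers
  have hint : z * (h / N : ℕ) = (s.val : ℤ) + m * h := by
    have hq : (N : ℚ) * ((h / N : ℕ) : ℚ) = h := by exact_mod_cast Nat.mul_div_cancel' hN
    have : ((z * (h / N : ℕ) : ℤ) : ℚ) = (((s.val : ℤ) + m * h : ℤ) : ℚ) := by
      rw [Int.cast_mul, Int.cast_natCast, ← hzq, mul_assoc, hq, hζ, add_mul, div_mul_cancel₀ _ hh0]
      push_cast
      ring
    exact_mod_cast this
  rw [hint]
  push_cast
  rw [ZMod.natCast_zmod_val, ZMod.natCast_self, mul_zero, add_zero]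

end Scale

/-! ### The order of the group generated by the rows -/

/-- `getD` on `(List.range n).map f`. [folklore] -/
theorem getD_map_range' {β : Type*} {f : ℕ → β} {n j : ℕ} (hj : j < n) (d : β) : ((List.range n).map f).getD j d = f j := by
  rw [List.getD_eq_getElem?_getD, List.getElem?_map, List.getElem?_range hj]; rfl

/-- **The subgroup-order algorithm on the natural rows computes `|⟨s_i⟩|`.** If row `i` has entries
`rows i t = s_{i,t}.val / h + (integer)` (`t < T`) for vectors `s_i ∈ (ℤ/h)^T`, `N ∣ h`, `N ≠ 0`, and every `(rows i t).den ∣ N`, then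
`subgroupOrderPure N T (natRows N rows) = |⟨s_0, …, s_{n-1}⟩|` (the natural rows generate the image of `⟨s_i⟩` under the inverse of
the embedding `scaleHom : (ℤ/N)^T ↪ (ℤ/h)^T`). [cite: CheungMosca2001, §3; Hallgren2005, §4] -/
theorem subgroupOrderPure_natRows_eq_card {h T n N : ℕ} [NeZero h] (rows : Fin n → ℕ → ℚ) (s : Fin n → Fin T → ZMod h)
    (hrows : ∀ (i : Fin n) (t : Fin T), ∃ m : ℤ, rows i t = ((s i t).val : ℚ) / h + m) (hN : N ∣ h) (hN0 : N ≠ 0)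
    (hden : ∀ (i : Fin n) (t : Fin T), (rows i t).den ∣ N) :
    Hallgren2005.Howell.subgroupOrderPure N T (natRows N (List.ofFn fun i => (List.range T).map (rows i))) =
      Nat.card (AddSubgroup.closure (Set.range s)) := by
  haveI : NeZero N := ⟨hN0⟩
  -- the natural entries and their residue vectors
  set g : ℚ → ℕ := fun ζ => (((ζ * (N : ℚ)).num % (N : ℤ)).toNat) with hg
  set v : Fin n → Fin T → ZMod N := fun i t => ((g (rows i t) : ℕ) : ZMod N) with hv
  have hnat : natRows N (List.ofFn fun i => (List.range T).map (rows i)) =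
      List.ofFn fun i => (List.range T).map (g ∘ rows i) := by
    simp only [natRows, List.map_ofFn, hg]
    congr 1
    funext i
    simp only [Function.comp_apply, List.map_map]
  -- to `subgroupOrderNat` and the closure
  rw [← Hallgren2005.Howell.subgroupOrderNat_getD_eq_pure, Hallgren2005.subgroupOrderNat, dif_neg hN0,
    Hallgren2005.SubgroupOrder.subgroupOrder_eq_card_closure]
  have hlist : ((natRows N (List.ofFn fun i => (List.range T).map (rows i))).map fun r (i : Fin T) => r.getD i 0).map
      (fun r (i : Fin T) => ((r i : ℕ) : ZMod N)) = List.ofFn v := by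
    rw [hnat, List.map_ofFn, List.map_ofFn]
    congr 1
    funext i t
    simp only [Function.comp_apply, hv]
    rw [getD_map_range' t.isLt]
    rfl
  rw [hlist]
  have hset : {w : Fin T → ZMod N | w ∈ List.ofFn v} = Set.range v := by
    ext w
    simp only [Set.mem_setOf_eq, List.mem_ofFn, Set.mem_range]
  rw [hset]
  -- push forward along the injective `scaleHom`
  set Φ : (Fin T → ZMod N) →+ (Fin T → ZMod h) := (scaleHom hN).compLeft (Fin T) with hΦ
  have hΦinj : Function.Injective Φ := fun a b hab => funext fun t =>
    scaleHom_injective hN (NeZero.ne h) (congrFun hab t)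
  have hΦv : (Φ : (Fin T → ZMod N) → (Fin T → ZMod h)) ∘ v = s := by
    funext i t
    obtain ⟨m, hm⟩ := hrows i t
    simp only [Function.comp_apply, hΦ, AddMonoidHom.compLeft_apply, hv]
    exact scaleHom_entry hN hm (hden i t)
  rw [← AddSubgroup.card_map_of_injective hΦinj, AddMonoidHom.map_closure, ← Set.range_comp, hΦv]

/-- **The subgroup-order algorithm on the natural rows computes `|⟨s_i⟩|`**, uncurried summary form of
`subgroupOrderPure_natRows_eq_card`. [cite: CheungMosca2001, §3; Hallgren2005, §4] -/
theorem subgroupOrderPure_rows_eq_card_closure : ∀ (h T n N : ℕ) [NeZero h] (rows : Fin n → ℕ → ℚ)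
    (s : Fin n → Fin T → ZMod h), (∀ (i : Fin n) (t : Fin T), ∃ m : ℤ, rows i t = ((s i t).val : ℚ) / h + m) → N ∣ h →
    N ≠ 0 → (∀ (i : Fin n) (t : Fin T), (rows i t).den ∣ N) →
    Hallgren2005.Howell.subgroupOrderPure N T (CubicClassPost.natRows N (List.ofFn fun i => (List.range T).map (rows i))) =
      Nat.card (AddSubgroup.closure (Set.range s)) :=
  fun _ _ _ _ _ rows s hrows hN hN0 hden => subgroupOrderPure_natRows_eq_card rows s hrows hN hN0 hden

end CubicClassPost

end Literature.Computability.Cryptography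

end
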